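import Literature.NumberTheory.ModularForms.GammaTranslatesCramer
import HarnessLib

/-!
# Descent: the companions `F_i` of an orbit datum have `K`-rational `q_N`-expansions

Topic `Literature/NumberTheory/ModularForms`; namespace `Literature.NumberTheory.ModularForms`.
Third file on the `K`-rationality of `SL₂(ℤ)`-translates of forms on `Γ(N)` (Shimura Thm. 6.6,
Prop. 6.9).  For an orbit datum (`GammaTranslatesCramer`: pairwise distinct `s_i ∈ M_{w₀}(Γ(N))`
and companions `F_i ∈ M_k(Γ(N))` permuted alike by `SL₂(ℤ)`, transitively) with all `s_i`
`K`-rational and ONE `F_{i₀}` `K`-rational, every `F_i` is `K`-rational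
(`isRat_of_orbitDatum`).  Proof (Shimura's, with Lagrange–Cramer resolvents in place of the field
`𝔉_N`): by Cramer `δ² F_{i₀} = ∑_l s_{i₀}^l M_l` with `M_l = δ·cram_l` of level one; level-one
forms are `ℂ`-combinations of `K`-rational ones (`levelOneSpace_le_span_isRat`), and since
`δ² F_{i₀}` and the `s_{i₀}^l m` are `K`-rational the coefficients may be taken in `K`
(`exists_coords_mem_of_forall_mem`, linear disjointness of `ℂ` and `K⟦q⟧` over `K`), giving
`δ² F_{i₀} = ∑_l s_{i₀}^l M'_l` with `K`-rational level-one `M'_l` (an identity of forms on `Γ(N)`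
by the `q`-expansion principle at `∞`); slashing by `γ` with `σ_γ i₀ = i` turns it into
`δ² F_i = ∑_l s_i^l M'_l` (`δ ∣ γ = ±δ`, `M'_l ∣ γ = M'_l`), whose right side is `K`-rational, and
division by the `K`-rational `δ² ≢ 0` (`IsRat.of_mul_left`) finishes.

Everything is proved (no definitions, no named facts).

## References

* [ShimuraIATAF1971] G. Shimura, *Introduction to the arithmetic theory of automorphic
  functions*, Princeton (1971), §6.1–6.2, Thm. 6.6 and Prop. 6.9 (proofs).
-/

noncomputable section

namespace Literature.NumberTheory.ModularForms

open scoped MatrixGroups Real CongruenceSubgroup Matrix ModularForm Topology Manifold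
open UpperHalfPlane hiding I
open Complex Filter Function ModularForm PowerSeries
open Literature.NumberTheory.EllipticCurves.ModularForms (formSpace levelOneSpace mem_formSpace
  mem_formSpace_iff coe_mem_formSpace mul_mem_formSpace pow_mem_formSpace formSpace_mono
  mdifferentiable_of_mem_formSpace slash_eq_of_mem_formSpace isBoundedAtImInfty_slash_of_mem_formSpace
  eq_zero_of_mul_eq_zero_of_mdifferentiable)

/-! ### More algebra of `formSpace Γ(N)` and `IsRat` -/

section Algebra

variable {K : Subfield ℂ} {N : ℕ} [NeZero N]

/-- Finite products: `∏_{i ∈ t} f_i ∈ M_{∑ w_i}(Γ)` for `f_i ∈ M_{w_i}(Γ)`. [folklore] -/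
theorem prod_mem_formSpace {Γ : Subgroup (GL (Fin 2) ℝ)} [Γ.HasDetOne] {ι : Type*} (t : Finset ι)
    {w : ι → ℤ} {f : ι → ℍ → ℂ} (hf : ∀ i ∈ t, f i ∈ formSpace Γ (w i)) :
    ∏ i ∈ t, f i ∈ formSpace Γ (∑ i ∈ t, w i) := by
  classical
  induction t using Finset.induction_on with
  | empty =>
    simp only [Finset.prod_empty, Finset.sum_empty]
    exact ⟨1, ModularForm.one_coe_eq_one⟩
  | insert a t ha ih =>
    rw [Finset.prod_insert ha, Finset.sum_insert ha]
    exact mul_mem_formSpace (hf a (Finset.mem_insert_self a t))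
      (ih fun i hi ↦ hf i (Finset.mem_insert_of_mem hi))

/-- Finite products of `K`-rational forms are `K`-rational. [folklore] -/
theorem IsRat.finset_prod {ι : Type*} (t : Finset ι) {w : ι → ℤ} {f : ι → ℍ → ℂ}
    (hf : ∀ i ∈ t, f i ∈ formSpace (CongruenceSubgroup.Gamma N) (w i))
    (hfK : ∀ i ∈ t, IsRat K N (f i)) : IsRat K N (∏ i ∈ t, f i) := by
  classical
  induction t using Finset.induction_on with
  | empty => rw [Finset.prod_empty]; exact isRat_one
  | insert a t ha ih =>
    rw [Finset.prod_insert ha]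
    have ht : ∀ i ∈ t, f i ∈ formSpace (CongruenceSubgroup.Gamma N) (w i) :=
      fun i hi ↦ hf i (Finset.mem_insert_of_mem hi)
    exact IsRat.mul (hf a (Finset.mem_insert_self a t)) (prod_mem_formSpace t ht)
      (hfK a (Finset.mem_insert_self a t)) (ih ht fun i hi ↦ hfK i (Finset.mem_insert_of_mem hi))

/-- Differences. [folklore] -/
theorem IsRat.sub {k : ℤ} {f g : ℍ → ℂ} (hf : f ∈ formSpace (CongruenceSubgroup.Gamma N) k)
    (hg : g ∈ formSpace (CongruenceSubgroup.Gamma N) k) (hfK : IsRat K N f) (hgK : IsRat K N g) :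
    IsRat K N (f - g) := fun n ↦ by
  rw [qExpansion_sub (analyticAt_cuspFunction_of_mem hf) (analyticAt_cuspFunction_of_mem hg),
    map_sub]
  exact sub_mem (hfK n) (hgK n)

/-- **The Vandermonde determinant of `K`-rational forms is `K`-rational**
(`δ = ∏_{i<j}(s_j - s_i)`). [folklore] -/
theorem isRat_vdmDet {r : ℕ} {w₀ : ℤ} {s : Fin r → ℍ → ℂ}
    (hs : ∀ i, s i ∈ formSpace (CongruenceSubgroup.Gamma N) w₀) (hsK : ∀ i, IsRat K N (s i)) :
    IsRat K N (vdmDet s) := by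
  rw [vdmDet_eq_prod]
  refine IsRat.finset_prod (w := fun i ↦ ∑ j ∈ Finset.Ioi i, w₀) _
    (fun i _ ↦ prod_mem_formSpace _ fun j _ ↦ Submodule.sub_mem _ (hs j) (hs i))
    (fun i _ ↦ IsRat.finset_prod (w := fun _ ↦ w₀) _ (fun j _ ↦ Submodule.sub_mem _ (hs j) (hs i))
      fun j _ ↦ IsRat.sub (hs j) (hs i) (hsK j) (hsK i))

/-- `(f^n) ∣_{n k} γ = (f ∣_k γ)^n`. [folklore] -/
theorem pow_slash_SL2 (f : ℍ → ℂ) (k : ℤ) (γ : SL(2, ℤ)) (n : ℕ) :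
    (f ^ n) ∣[(n : ℤ) * k] γ = (f ∣[k] γ) ^ n := by
  induction n with
  | zero =>
    simp only [pow_zero, Nat.cast_zero, zero_mul]
    exact ModularForm.is_invariant_one γ
  | succ n ih =>
    rw [pow_succ, pow_succ, show ((n + 1 : ℕ) : ℤ) * k = n * k + k by push_cast; ring,
      ModularForm.mul_slash_SL2, ih]

/-- **Linearity of the `q_N`-expansion on finite combinations** of members of
`formSpace Γ(N) κ`: `coeff n (qExpansion N (∑_j c_j f_j)) = ∑_j c_j coeff n (qExpansion N f_j)`.
[folklore] -/
theorem qExpansion_coeff_sum_smul {ι : Type*} (t : Finset ι) {κ : ℤ} {f : ι → ℍ → ℂ}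
    (hf : ∀ j ∈ t, f j ∈ formSpace (CongruenceSubgroup.Gamma N) κ) (c : ι → ℂ) (n : ℕ) :
    (qExpansion (N : ℝ) (∑ j ∈ t, c j • f j)).coeff n =
      ∑ j ∈ t, c j * (qExpansion (N : ℝ) (f j)).coeff n := by
  classical
  induction t using Finset.induction_on with
  | empty => simp [qExpansion_zero]
  | insert a t ha ih =>
    have ht : ∀ j ∈ t, f j ∈ formSpace (CongruenceSubgroup.Gamma N) κ :=
      fun j hj ↦ hf j (Finset.mem_insert_of_mem hj)
    have ha' := hf a (Finset.mem_insert_self a t)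
    have hsmul : c a • f a ∈ formSpace (CongruenceSubgroup.Gamma N) κ := Submodule.smul_mem _ _ ha'
    have hrest : ∑ j ∈ t, c j • f j ∈ formSpace (CongruenceSubgroup.Gamma N) κ :=
      Submodule.sum_mem _ fun j hj ↦ Submodule.smul_mem _ _ (ht j hj)
    rw [Finset.sum_insert ha, Finset.sum_insert ha,
      qExpansion_add (analyticAt_cuspFunction_of_mem hsmul) (analyticAt_cuspFunction_of_mem hrest),
      map_add, ih ht, qExpansion_smul (analyticAt_cuspFunction_of_mem ha'), map_smul, smul_eq_mul]

end Algebra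

/-! ### The descent theorem -/

section Descent

variable {K : Subfield ℂ} {N : ℕ} [NeZero N] {r : ℕ} {w₀ k : ℤ} {s F : Fin r → ℍ → ℂ}
  {σ : SL(2, ℤ) → Equiv.Perm (Fin r)}

/-- `𝒮ℒ`-membership of the image of `γ ∈ SL₂(ℤ)` in `GL(2, ℝ)`. [folklore] -/
theorem coe_mem_SL (γ : SL(2, ℤ)) : (γ : GL (Fin 2) ℝ) ∈ 𝒮ℒ := ⟨γ, rfl⟩

/-- **Descent theorem** (Shimura Thm. 6.6 / Prop. 6.9 in resolvent form): for an orbit datum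
`(s_i ∈ M_{w₀}(Γ(N)), F_i ∈ M_k(Γ(N)), σ)` — `s_i ∣ γ = s_{σ_γ i}`, `F_i ∣ γ = F_{σ_γ i}`, the
`s_i` pairwise distinct and `K`-rational, `σ` transitive from `i₀` — if `F_{i₀}` has a
`K`-rational `q_N`-expansion then so does every `F_i`. [cite: ShimuraIATAF1971, Thm. 6.6 and Prop. 6.9] -/
theorem isRat_of_orbitDatum (hs : ∀ i, s i ∈ formSpace (CongruenceSubgroup.Gamma N) w₀)
    (hF : ∀ i, F i ∈ formSpace (CongruenceSubgroup.Gamma N) k)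
    (hsσ : ∀ γ i, s i ∣[w₀] γ = s (σ γ i)) (hFσ : ∀ γ i, F i ∣[k] γ = F (σ γ i))
    (hinj : Function.Injective s) (hsK : ∀ i, IsRat K N (s i))
    (i₀ : Fin r) (hF₀ : IsRat K N (F i₀)) (htrans : ∀ i, ∃ γ : SL(2, ℤ), σ γ i₀ = i) (i : Fin r) :
    IsRat K N (F i) := by
  classical
  -- weights
  set T : ℤ := ∑ j : Fin r, (j : ℤ) with hT
  let W : Fin r → ℤ := fun l ↦ w₀ * T + (k + w₀ * (T - l))
  set κ : ℤ := w₀ * T + (w₀ * T + k) with hκ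
  have hWκ : ∀ l : Fin r, ((l : ℕ) : ℤ) * w₀ + W l = κ := fun l ↦ by simp only [W, hκ]; ring
  -- memberships
  have hδ : vdmDet s ∈ formSpace (CongruenceSubgroup.Gamma N) (w₀ * T) := vdmDet_mem_formSpace hs hsσ hinj
  have hδK : IsRat K N (vdmDet s) := isRat_vdmDet hs hsK
  have hpow : ∀ (i : Fin r) (l : Fin r), s i ^ (l : ℕ) ∈
      formSpace (CongruenceSubgroup.Gamma N) (((l : ℕ) : ℤ) * w₀) := fun i l ↦ pow_mem_formSpace (hs i) l
  have hpowK : ∀ (i : Fin r) (l : Fin r), IsRat K N (s i ^ (l : ℕ)) := fun i l ↦ IsRat.pow (hs i) (hsK i) l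
  -- Step 1: `M_l = δ · cram_l` is a finite `ℂ`-combination of `K`-rational level-one forms
  have hM : ∀ l : Fin r, ∃ (n : ℕ) (c : Fin n → ℂ) (m : Fin n → ℍ → ℂ),
      (∀ t, m t ∈ levelOneSpace (W l) ∧ IsRat K N (m t)) ∧
      vdmDet s * cram s F l = ∑ t, c t • m t := by
    intro l
    have hmem := levelOneSpace_le_span_isRat K N _ (vdmDet_mul_cram_mem_levelOne hs hF hsσ hFσ l)
    rw [Submodule.mem_span_set'] at hmem
    obtain ⟨n, c, m, hsum⟩ := hmem
    exact ⟨n, c, fun t ↦ (m t : ℍ → ℂ), fun t ↦ (m t).2, hsum.symm⟩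
  choose n c m hm hsum using hM
  -- the rational building blocks `u_{l,t} = s_{i₀}^l m_{l,t} ∈ M_κ(Γ(N))`
  have hmΓ : ∀ (l : Fin r) (t : Fin (n l)), m l t ∈ formSpace (CongruenceSubgroup.Gamma N) (W l) :=
    fun l t ↦ mem_formSpace_Gamma_of_levelOne N (hm l t).1
  have hu : ∀ (j : Fin r) (l : Fin r) (t : Fin (n l)),
      s j ^ (l : ℕ) * m l t ∈ formSpace (CongruenceSubgroup.Gamma N) κ := fun j l t ↦ by
    rw [← hWκ l]
    exact mul_mem_formSpace (hpow j l) (hmΓ l t)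
  have huK : ∀ (j : Fin r) (l : Fin r) (t : Fin (n l)), IsRat K N (s j ^ (l : ℕ) * m l t) :=
    fun j l t ↦ IsRat.mul (hpow j l) (hmΓ l t) (hpowK j l) (hm l t).2
  -- Step 2: the identity at `i₀`: `δ² F_{i₀} = ∑_{l,t} c_{l,t} u_{l,t}`
  have hid₀ : vdmDet s * (vdmDet s * F i₀) =
      ∑ x : (Σ l : Fin r, Fin (n l)), c x.1 x.2 • (s i₀ ^ (x.1 : ℕ) * m x.1 x.2) := by
    rw [vdmDet_mul_eq_sum i₀, Finset.mul_sum, ← Finset.univ_sigma_univ, Finset.sum_sigma]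
    refine Finset.sum_congr rfl fun l _ ↦ ?_
    rw [mul_left_comm, hsum l, Finset.mul_sum]
    refine Finset.sum_congr rfl fun t _ ↦ ?_
    rw [mul_smul_comm]
  -- its `q_N`-expansion, and descent of the coefficients to `K`
  have hLHS : vdmDet s * (vdmDet s * F i₀) ∈ formSpace (CongruenceSubgroup.Gamma N) κ :=
    mul_mem_formSpace hδ (mul_mem_formSpace hδ (hF i₀))
  have hLHSK : IsRat K N (vdmDet s * (vdmDet s * F i₀)) :=
    IsRat.mul hδ (mul_mem_formSpace hδ (hF i₀)) hδK (IsRat.mul hδ (hF i₀) hδK hF₀)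
  obtain ⟨c', hc'K, hc'⟩ := exists_coords_mem_of_forall_mem K
    (fun (x : Σ l : Fin r, Fin (n l)) (n' : ℕ) ↦ (qExpansion (N : ℝ) (s i₀ ^ (x.1 : ℕ) * m x.1 x.2)).coeff n')
    (fun x n' ↦ huK i₀ x.1 x.2 n') (fun x ↦ c x.1 x.2)
    (fun n' ↦ (qExpansion (N : ℝ) (vdmDet s * (vdmDet s * F i₀))).coeff n') hLHSK
    (fun n' ↦ by rw [hid₀, qExpansion_coeff_sum_smul _ (fun x _ ↦ hu i₀ x.1 x.2)])
  -- Step 3: the `K`-rational level-one forms `M'_l = ∑_t c'_{l,t} m_{l,t}`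
  let M' : Fin r → ℍ → ℂ := fun l ↦ ∑ t : Fin (n l), c' ⟨l, t⟩ • m l t
  have hM'₁ : ∀ l, M' l ∈ levelOneSpace (W l) := fun l ↦
    Submodule.sum_mem _ fun t _ ↦ Submodule.smul_mem _ _ (hm l t).1
  have hM'Γ : ∀ l, M' l ∈ formSpace (CongruenceSubgroup.Gamma N) (W l) := fun l ↦
    mem_formSpace_Gamma_of_levelOne N (hM'₁ l)
  have hM'K : ∀ l, IsRat K N (M' l) := fun l ↦
    IsRat.sum (k := W l) _ (fun t _ ↦ Submodule.smul_mem _ _ (hmΓ l t))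
      fun t _ ↦ IsRat.smul (hmΓ l t) (hm l t).2 (hc'K _)
  -- Step 4: `δ² F_{i₀} = ∑_l s_{i₀}^l M'_l` as functions (equal `q_N`-expansions)
  have hRHS : ∀ j : Fin r, ∑ l : Fin r, s j ^ (l : ℕ) * M' l ∈ formSpace (CongruenceSubgroup.Gamma N) κ :=
    fun j ↦ Submodule.sum_mem _ fun l _ ↦ by rw [← hWκ l]; exact mul_mem_formSpace (hpow j l) (hM'Γ l)
  have hRHSK : ∀ j : Fin r, IsRat K N (∑ l : Fin r, s j ^ (l : ℕ) * M' l) := fun j ↦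
    IsRat.sum (k := κ) _ (fun l _ ↦ by rw [← hWκ l]; exact mul_mem_formSpace (hpow j l) (hM'Γ l))
      fun l _ ↦ IsRat.mul (hpow j l) (hM'Γ l) (hpowK j l) (hM'K l)
  have hexp : ∀ j : Fin r, ∑ l : Fin r, s j ^ (l : ℕ) * M' l =
      ∑ x : (Σ l : Fin r, Fin (n l)), c' x • (s j ^ (x.1 : ℕ) * m x.1 x.2) := by
    intro j
    rw [← Finset.univ_sigma_univ, Finset.sum_sigma]
    refine Finset.sum_congr rfl fun l _ ↦ ?_
    simp only [M', Finset.mul_sum]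
    refine Finset.sum_congr rfl fun t _ ↦ ?_
    rw [mul_smul_comm]
  have hid : vdmDet s * (vdmDet s * F i₀) = ∑ l : Fin r, s i₀ ^ (l : ℕ) * M' l := by
    refine eq_of_qExpansion_eq_of_mem hLHS (hRHS i₀) (PowerSeries.ext fun n' ↦ ?_)
    rw [hc' n', hexp i₀, qExpansion_coeff_sum_smul _ (fun x _ ↦ hu i₀ x.1 x.2)]
  -- Step 5: slash by `γ` with `σ_γ i₀ = i`
  obtain ⟨γ, hγ⟩ := htrans i
  have hslash : (vdmDet s * (vdmDet s * F i₀)) ∣[κ] γ = (∑ l : Fin r, s i₀ ^ (l : ℕ) * M' l) ∣[κ] γ :=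
    congrArg (fun f : ℍ → ℂ ↦ f ∣[κ] γ) hid
  have hL : (vdmDet s * (vdmDet s * F i₀)) ∣[κ] γ = vdmDet s * (vdmDet s * F i) := by
    rw [hκ, ModularForm.mul_slash_SL2, ModularForm.mul_slash_SL2, vdmDet_slash γ (σ γ) (hsσ γ),
      hFσ γ i₀, hγ, smul_mul_assoc, smul_mul_assoc, mul_smul_comm, smul_smul, sign_mul_sign, one_smul]
  have hR : (∑ l : Fin r, s i₀ ^ (l : ℕ) * M' l) ∣[κ] γ = ∑ l : Fin r, s i ^ (l : ℕ) * M' l := by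
    rw [SlashAction.sum_slash]
    refine Finset.sum_congr rfl fun l _ ↦ ?_
    rw [← hWκ l, ModularForm.mul_slash_SL2, pow_slash_SL2, hsσ γ i₀, hγ,
      show M' l ∣[W l] γ = M' l from slash_eq_of_mem_formSpace (hM'₁ l) (coe_mem_SL γ)]
  rw [hL, hR] at hslash
  -- Step 6: divide by the `K`-rational `δ² ≢ 0`
  have hδ0 : vdmDet s ≠ 0 := vdmDet_ne_zero (fun i ↦ mdifferentiable_of_mem_formSpace (hs i)) hinj
  have hδδ0 : vdmDet s * vdmDet s ≠ 0 := fun h ↦ hδ0 (eq_zero_of_mul_eq_zero_of_mdifferentiable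
    (mdifferentiable_of_mem_formSpace hδ) hδ0 (mdifferentiable_of_mem_formSpace hδ).continuous h)
  refine IsRat.of_mul_left (mul_mem_formSpace hδ hδ) (hF i) hδδ0 ?_ (IsRat.mul hδ hδ hδK hδK) (hRHSK i)
  rw [mul_assoc, hslash]

end Descent

end Literature.NumberTheory.ModularForms

end
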